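import Summits.QuantumFields.YangMills.Theorems.BalabanUVNodesN20BlockCaricatureCountStatistic
import Literature.Probability.Distributions.ExponentialOrderStatistics

/-!
# BalabanUVNodes ∕ N20·N19′·N21 — ON THE EXCHANGEABLE CARICATURE THE OPTIMAL TWO-RUN CLASS SET IS A TAIL EVENT OF THE LARGE-FIELD COUNT (FILE S): the binomial likelihood ratio is
# monotone in the count, so the Hahn set `{Bin(n,p) < Bin(n,q)}` is a tail `{k ≥ m}` and `2·TV(Bin(n,p), Bin(n,q)) = Σ_k C(n,k)|q^k(1−q)^{n−k} − p^k(1−p)^{n−k}|` EQUALS twice ONE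
# tail gap `binomTail n m q − binomTail n m p` — every other threshold gives at most that (FILE J's tail test is optimal up to the choice of threshold)

Cell `pub-ymgap` (HUMAN RULING D-0062 Track A; work-bound push D-0149, director-ym №197), width seat `pub-ymgap-dag-n20-w1` (gen 7) on node N20 = NE7b; key item of this
seat's payload K3⁷ `SpineGivenEndpointR13SepCoPH` = stmt-QuantumFields-20544 (ASIDE; lineage of K3⁸ `SpineGivenEndpointR13SepCoPHV` = stmt-QuantumFields-27366, skeleton v6
b4e55110ab73e679 UNTOUCHED; `--kind proof --supports 20544 --as helper`, MIS-KEY rule R463 (4)(a)); COUNT-NEUTRAL.  Bus: CLAIM-23 ∕ INTENT-28.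
THEOREMS ONLY (0 def ∕ instance ∕ notation ∕ sorry); imports this seat's FILE F `…N20BlockCaricatureCountStatistic` (through it FILE D §1 `sum_abs_sub_eq_two_mul_hahnGap`, FILE A
`abs_sub_le_half_sum_abs`, `sum_count_eq_one`) and the tree's `Literature/Probability/Distributions/ExponentialOrderStatistics` (`binomTail`, ABN (2.2.13)) BY NAME.

WHY.  FILE J (p623504) bounded the count ℓ¹ `ℓ = 2·TV(Bin(n,p), Bin(n,q))` from BELOW by the gap of ONE tail event `{count ≥ ⌊n r⋆⌋ + 1}`; FILE N (p628223) turned summable class-law TV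
radii into a MOMENT ∕ THRESHOLD test a disprover can point at the record.  This file records WHY tail events are the right class sets on the exchangeable caricature and that nothing is
lost there: the binomial likelihood ratio `(q∕p)^k((1−q)∕(1−p))^{n−k}` is MONOTONE in the count `k` (`p ≤ q`; §1 `atom_cross_le`, the MLR property [folklore, Karlin–Rubin]), so the
set where run B's count law exceeds run A's is an UPPER set `{m ≤ k ≤ n}` (§2 `hahnSet_count_eq_Icc`), and the Hahn decomposition (FILE D §1) gives ★★ `l1Count_eq_two_mul_tailGap`:
`ℓ = 2·(binomTail n m q − binomTail n m p)` for SOME threshold `m ≤ n + 1`, while EVERY threshold's tail gap is `≤ ℓ∕2` (`tailGap_le_half_l1Count`, FILE A) — ★★ `isGreatest_tailGap`: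
`ℓ∕2` IS the largest tail gap.  So on the caricature the optimal distinguishing class set between the two runs is «at least `m` large-field blocks»; FILE J's test loses only the
choice of threshold, and FILE N's count-threshold sets are the right SHAPE for a record-level kill (there, without independence, optimality is not claimed).
LOCATED READING (caricature currency; for cdisprove-to-be ∕ CRIT-1): a disprover hunting law separation of the two runs' keyed class laws may restrict to COUNT-TAIL class sets
«≥ m large-field blocks in the key» without loss on the exchangeable caricature; with per-block rates (FILE Q) the analogous one-sided sets are the union events used there.

HONEST FRAMING.  [folklore] finite-sum probability about the BINOMIAL law (monotone likelihood ratio; Hahn decomposition) on a CARICATURE (independent exchangeable blocks); nothing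
read at the record; proves NO estimate of Bałaban's; refutes NO registered stub; nothing of Bałaban's asserted or instantiated.  NE7 ∕ NE7b ∕ NE7c NOT PRINTED for `d = 4`, NOT proved;
N19 ∕ N20 ∕ N21 NOT discharged; K3⁸ ∕ K3⁷ OPEN; counts unmoved (typed 28∕28 · discharged 5∕27); no count claim.  One finite `𝕋⁴_{L^K}` programme at fixed `ε = L^{−K}`, Bałaban AS PRINTED;
the YM mass gap (Clay) is NOT proved by any of this — R4 closes the conditional finite-𝕋⁴ rung `BalabanLadder.UV` only; NOT ℝ⁴, NOT OS.  No decl carries a cite tag.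
-/

noncomputable section

open Finset
open Literature.Probability.Distributions.ExponentialOrderStatistics (binomTail)
open Summit.QuantumFields.YangMills.BalabanUVNodes.N20BlockCaricatureAffinity (abs_sub_le_half_sum_abs)
open Summit.QuantumFields.YangMills.BalabanUVNodes.N20BlockCaricatureExactCriterion (sum_abs_sub_eq_two_mul_hahnGap)
open Summit.QuantumFields.YangMills.BalabanUVNodes.N20BlockCaricatureCountStatistic (sum_count_eq_one)

namespace Summit.QuantumFields.YangMills.BalabanUVNodes.N20BlockCaricatureTailOptimal

variable {p q : ℝ}

/-! ## §1 Monotone likelihood ratio of the binomial family -/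

/-- **MLR** [folklore, Karlin–Rubin]: for `0 ≤ p ≤ q ≤ 1` and counts `k ≤ k' ≤ n`, `q^k(1−q)^{n−k}·p^{k'}(1−p)^{n−k'} ≤ p^k(1−p)^{n−k}·q^{k'}(1−q)^{n−k'}` — the likelihood ratio
of `Bin(n,q)` to `Bin(n,p)` is non-decreasing in the count (`(1−q)p ≤ (1−p)q`). -/
theorem atom_cross_le (hp0 : 0 ≤ p) (hpq : p ≤ q) (hq1 : q ≤ 1) {k k' n : ℕ} (hkk' : k ≤ k') (hk'n : k' ≤ n) :
    q ^ k * (1 - q) ^ (n - k) * (p ^ k' * (1 - p) ^ (n - k')) ≤ p ^ k * (1 - p) ^ (n - k) * (q ^ k' * (1 - q) ^ (n - k')) := by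
  obtain ⟨d, rfl⟩ := Nat.exists_eq_add_of_le hkk'
  have hnk : n - k = (n - (k + d)) + d := by omega
  have hC : 0 ≤ p ^ k * q ^ k * (1 - p) ^ (n - (k + d)) * (1 - q) ^ (n - (k + d)) :=
    mul_nonneg (mul_nonneg (mul_nonneg (pow_nonneg hp0 _) (pow_nonneg (hp0.trans hpq) _)) (pow_nonneg (by linarith) _)) (pow_nonneg (sub_nonneg.2 hq1) _)
  have hle : (1 - q) ^ d * p ^ d ≤ (1 - p) ^ d * q ^ d := by
    rw [← mul_pow, ← mul_pow]
    exact pow_le_pow_left₀ (mul_nonneg (sub_nonneg.2 hq1) hp0) (by nlinarith) d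
  calc q ^ k * (1 - q) ^ (n - k) * (p ^ (k + d) * (1 - p) ^ (n - (k + d)))
      = p ^ k * q ^ k * (1 - p) ^ (n - (k + d)) * (1 - q) ^ (n - (k + d)) * ((1 - q) ^ d * p ^ d) := by rw [hnk]; ring
    _ ≤ p ^ k * q ^ k * (1 - p) ^ (n - (k + d)) * (1 - q) ^ (n - (k + d)) * ((1 - p) ^ d * q ^ d) := mul_le_mul_of_nonneg_left hle hC
    _ = p ^ k * (1 - p) ^ (n - k) * (q ^ (k + d) * (1 - q) ^ (n - (k + d))) := by rw [hnk]; ring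

/-- Consequently the set where run B's atom exceeds run A's is UPWARD CLOSED in the count (`0 < p < 1`, `p ≤ q ≤ 1`). [folklore] -/
theorem atom_lt_mono (hp0 : 0 < p) (hp1 : p < 1) (hpq : p ≤ q) (hq1 : q ≤ 1) {k k' n : ℕ} (hkk' : k ≤ k') (hk'n : k' ≤ n)
    (h : p ^ k * (1 - p) ^ (n - k) < q ^ k * (1 - q) ^ (n - k)) : p ^ k' * (1 - p) ^ (n - k') < q ^ k' * (1 - q) ^ (n - k') := by
  have hcross := atom_cross_le hp0.le hpq hq1 hkk' hk'n
  have ha' : 0 < p ^ k' * (1 - p) ^ (n - k') := mul_pos (pow_pos hp0 _) (pow_pos (by linarith) _)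
  have ha : 0 ≤ p ^ k * (1 - p) ^ (n - k) := mul_nonneg (pow_nonneg hp0.le _) (pow_nonneg (by linarith) _)
  by_contra hnot
  have h1 : p ^ k * (1 - p) ^ (n - k) * (q ^ k' * (1 - q) ^ (n - k')) ≤ p ^ k * (1 - p) ^ (n - k) * (p ^ k' * (1 - p) ^ (n - k')) :=
    mul_le_mul_of_nonneg_left (not_lt.1 hnot) ha
  have h2 : p ^ k * (1 - p) ^ (n - k) * (p ^ k' * (1 - p) ^ (n - k')) < q ^ k * (1 - q) ^ (n - k) * (p ^ k' * (1 - p) ^ (n - k')) :=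
    mul_lt_mul_of_pos_right h ha'
  linarith

/-! ## §2 The Hahn set of the two count laws is a tail -/

/-- ★ **THE HAHN SET IS A TAIL** [folklore]: for `0 < p < 1`, `p ≤ q ≤ 1` there is a threshold `m ≤ n + 1` with
`{k ≤ n : C(n,k)p^k(1−p)^{n−k} < C(n,k)q^k(1−q)^{n−k}} = {m, …, n}` (empty iff `m = n + 1`). -/
theorem hahnSet_count_eq_Icc (hp0 : 0 < p) (hp1 : p < 1) (hpq : p ≤ q) (hq1 : q ≤ 1) (n : ℕ) :
    ∃ m, m ≤ n + 1 ∧ (Finset.range (n + 1)).filter (fun k => (n.choose k : ℝ) * p ^ k * (1 - p) ^ (n - k) < (n.choose k : ℝ) * q ^ k * (1 - q) ^ (n - k)) =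
      Finset.Icc m n := by
  set H := (Finset.range (n + 1)).filter (fun k => (n.choose k : ℝ) * p ^ k * (1 - p) ^ (n - k) < (n.choose k : ℝ) * q ^ k * (1 - q) ^ (n - k)) with hH
  -- membership in `H` is the atom comparison (the binomial coefficient is positive on `k ≤ n`)
  have hmem : ∀ k, k ∈ H ↔ k ≤ n ∧ p ^ k * (1 - p) ^ (n - k) < q ^ k * (1 - q) ^ (n - k) := by
    intro k
    rw [hH, Finset.mem_filter, Finset.mem_range, Nat.lt_succ_iff]
    constructor
    · rintro ⟨hk, hlt⟩
      have hc : (0 : ℝ) < n.choose k := by exact_mod_cast Nat.choose_pos hk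
      refine ⟨hk, ?_⟩
      rw [mul_assoc, mul_assoc] at hlt
      exact lt_of_mul_lt_mul_left hlt hc.le
    · rintro ⟨hk, hlt⟩
      have hc : (0 : ℝ) < n.choose k := by exact_mod_cast Nat.choose_pos hk
      refine ⟨hk, ?_⟩
      rw [mul_assoc, mul_assoc]
      exact mul_lt_mul_of_pos_left hlt hc
  rcases H.eq_empty_or_nonempty with he | hne
  · refine ⟨n + 1, le_rfl, ?_⟩
    rw [he, eq_comm, Finset.Icc_eq_empty_iff]
    omega
  · refine ⟨H.min' hne, ?_, ?_⟩
    · have := ((hmem _).1 (Finset.min'_mem H hne)).1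
      omega
    · ext k
      rw [Finset.mem_Icc]
      constructor
      · intro hk
        exact ⟨Finset.min'_le H k hk, ((hmem k).1 hk).1⟩
      · rintro ⟨hmk, hkn⟩
        have hm := (hmem _).1 (Finset.min'_mem H hne)
        exact (hmem k).2 ⟨hkn, atom_lt_mono hp0 hp1 hpq hq1 hmk hkn hm.2⟩

/-! ## §3 The count ℓ¹ is twice ONE tail gap, and that tail gap is the largest -/

/-- Every threshold's tail gap is at most HALF the count ℓ¹ (FILE A `abs_sub_le_half_sum_abs` on `{m, …, n} ⊆ {0, …, n}`; sharper by the factor `2` than FILE H's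
`abs_binomTail_sub_le_l1Count`). [folklore] -/
theorem tailGap_le_half_l1Count (p q : ℝ) (n m : ℕ) :
    |binomTail n m q - binomTail n m p| ≤ (∑ k ∈ Finset.range (n + 1), (n.choose k : ℝ) * |q ^ k * (1 - q) ^ (n - k) - p ^ k * (1 - p) ^ (n - k)|) / 2 := by
  have hsub : Finset.Icc m n ⊆ Finset.range (n + 1) := fun k hk => Finset.mem_range.2 (by have := (Finset.mem_Icc.1 hk).2; omega)
  have h := abs_sub_le_half_sum_abs (Finset.range (n + 1)) (a := fun k => (n.choose k : ℝ) * (p ^ k * (1 - p) ^ (n - k)))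
    (b := fun k => (n.choose k : ℝ) * (q ^ k * (1 - q) ^ (n - k))) (by rw [sum_count_eq_one, sum_count_eq_one]) hsub
  have e : ∀ k, |(n.choose k : ℝ) * (q ^ k * (1 - q) ^ (n - k)) - (n.choose k : ℝ) * (p ^ k * (1 - p) ^ (n - k))| =
      (n.choose k : ℝ) * |q ^ k * (1 - q) ^ (n - k) - p ^ k * (1 - p) ^ (n - k)| := fun k => by
    rw [← mul_sub, abs_mul, abs_of_nonneg (Nat.cast_nonneg _)]
  have ea : ∀ (r : ℝ) k, (n.choose k : ℝ) * r ^ k * (1 - r) ^ (n - k) = (n.choose k : ℝ) * (r ^ k * (1 - r) ^ (n - k)) := fun r k => mul_assoc _ _ _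
  simp only [e] at h
  unfold binomTail
  simp only [ea]
  exact h

/-- ★★ **THE COUNT ℓ¹ IS TWICE ONE TAIL GAP** [folklore]: for `0 < p < 1`, `p ≤ q ≤ 1` there is a threshold `m ≤ n + 1` with
`Σ_{k ≤ n} C(n,k)|q^k(1−q)^{n−k} − p^k(1−p)^{n−k}| = 2·(binomTail n m q − binomTail n m p)` — on the exchangeable caricature `TV(Bin(n,p), Bin(n,q))` is ATTAINED on the class set
«at least `m` large-field blocks» (Hahn decomposition, FILE D §1, on the tail of §2). -/
theorem l1Count_eq_two_mul_tailGap (hp0 : 0 < p) (hp1 : p < 1) (hpq : p ≤ q) (hq1 : q ≤ 1) (n : ℕ) :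
    ∃ m, m ≤ n + 1 ∧ ∑ k ∈ Finset.range (n + 1), (n.choose k : ℝ) * |q ^ k * (1 - q) ^ (n - k) - p ^ k * (1 - p) ^ (n - k)| =
      2 * (binomTail n m q - binomTail n m p) := by
  classical
  obtain ⟨m, hm, hH⟩ := hahnSet_count_eq_Icc hp0 hp1 hpq hq1 n
  refine ⟨m, hm, ?_⟩
  have h := sum_abs_sub_eq_two_mul_hahnGap (Finset.range (n + 1)) (a := fun k => (n.choose k : ℝ) * (p ^ k * (1 - p) ^ (n - k)))
    (b := fun k => (n.choose k : ℝ) * (q ^ k * (1 - q) ^ (n - k))) (by rw [sum_count_eq_one, sum_count_eq_one])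
  have e : ∀ k, |(n.choose k : ℝ) * (q ^ k * (1 - q) ^ (n - k)) - (n.choose k : ℝ) * (p ^ k * (1 - p) ^ (n - k))| =
      (n.choose k : ℝ) * |q ^ k * (1 - q) ^ (n - k) - p ^ k * (1 - p) ^ (n - k)| := fun k => by
    rw [← mul_sub, abs_mul, abs_of_nonneg (Nat.cast_nonneg _)]
  have ea : ∀ (r : ℝ) k, (n.choose k : ℝ) * r ^ k * (1 - r) ^ (n - k) = (n.choose k : ℝ) * (r ^ k * (1 - r) ^ (n - k)) := fun r k => mul_assoc _ _ _
  simp only [e] at h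
  rw [h]
  -- the Hahn set is the tail `{m, …, n}` (same predicate up to `mul_assoc` and the `DecidablePred` instance chosen by `classical`)
  have hH' : (Finset.range (n + 1)).filter (fun k => (n.choose k : ℝ) * (p ^ k * (1 - p) ^ (n - k)) < (n.choose k : ℝ) * (q ^ k * (1 - q) ^ (n - k))) =
      Finset.Icc m n := by
    rw [← hH]
    exact Finset.filter_congr fun k _ => by rw [ea, ea]
  unfold binomTail
  simp only [ea]
  rw [hH']

/-- ★★ **… AND IT IS THE LARGEST TAIL GAP** [folklore]: `ℓ∕2` is the greatest element of `{binomTail n m q − binomTail n m p : m ≤ n + 1}` — FILE J's tail test is optimal up to the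
choice of threshold, and on the exchangeable caricature nothing is lost by testing COUNT TAILS only. -/
theorem isGreatest_tailGap (hp0 : 0 < p) (hp1 : p < 1) (hpq : p ≤ q) (hq1 : q ≤ 1) (n : ℕ) :
    IsGreatest {x : ℝ | ∃ m, m ≤ n + 1 ∧ x = binomTail n m q - binomTail n m p}
      ((∑ k ∈ Finset.range (n + 1), (n.choose k : ℝ) * |q ^ k * (1 - q) ^ (n - k) - p ^ k * (1 - p) ^ (n - k)|) / 2) := by
  obtain ⟨m, hm, hl⟩ := l1Count_eq_two_mul_tailGap hp0 hp1 hpq hq1 n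
  refine ⟨⟨m, hm, by rw [hl]; ring⟩, ?_⟩
  rintro x ⟨m', -, rfl⟩
  exact (le_abs_self _).trans (tailGap_le_half_l1Count p q n m')

/-- The mirror statement for `q ≤ p` (swap the runs; the optimal class set is then a LOWER tail «at most `m − 1` large-field blocks», i.e. the complement of a tail). [folklore] -/
theorem l1Count_eq_two_mul_tailGap' (hq0 : 0 < q) (hq1 : q < 1) (hqp : q ≤ p) (hp1 : p ≤ 1) (n : ℕ) :
    ∃ m, m ≤ n + 1 ∧ ∑ k ∈ Finset.range (n + 1), (n.choose k : ℝ) * |q ^ k * (1 - q) ^ (n - k) - p ^ k * (1 - p) ^ (n - k)| =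
      2 * (binomTail n m p - binomTail n m q) := by
  obtain ⟨m, hm, h⟩ := l1Count_eq_two_mul_tailGap hq0 hq1 hqp hp1 n
  refine ⟨m, hm, ?_⟩
  rw [← h]
  exact Finset.sum_congr rfl fun k _ => by rw [abs_sub_comm]

end Summit.QuantumFields.YangMills.BalabanUVNodes.N20BlockCaricatureTailOptimal

end
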